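import Mathlib

/-!
# Skew-cut X0 certificate: the GRAPH BOUND of a section eigenvector from band + growth + pairing
(instab3 g6 — implementation 1 of the skew-cut X0 certifier, cell `ns-blowup`, 2026-08-27)

HONEST FRAMING (human rulings D-0035/D-0074): nothing here is a claim about Navier–Stokes
blow-up. WHAT THIS IS NOT: not NS evidence. MODEL-lane format bookkeeping; no certificate, printed
number or census word is moved.

The END-TO-END theorems of the X0 chain (`SkewCutGalerkinFromSections*`, `…FromResolventData`,
`SkewCutGalerkinRealShell`, `AbcCrayaEnds`, instab4's `AbcClassIIX0`) ask, besides the section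
eigenpairs, for a UNIFORM GRAPH BOUND `Σ_{j∈F} |(x₀ − ℓ_j) c_j|² ≤ C²` of the normalised section
eigenvectors (`hgraph`). instab3 g3's `SkewCutGalerkinBounds.graph_bound` derives it from the finer
model structure `a = G + F` (skew transport + bounded stretch). Here it is derived from the chain's own
STRUCTURAL data ALONE — band of width `W` (symmetric), growth `|a_ij| ≤ K w_j` with `w_j² ≤ 1 + |ℓ_j|`
(no sign needed on `K`),
levels `ℓ ≤ 0`, and the section pairing bound `uᵀ a u ≤ s |u|²`:

* `energy_bound_of_section_eigen`: `Σ_{i∈F} |ℓ_i| c_i² ≤ s − x` (pair the eigen-equation with `c`);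
* `sq_sum_band_le`: `(Σ_{j∈F} a_ij c_j)² ≤ W K² Σ_{j ∈ nbr i} w_j² c_j²` (Cauchy–Schwarz on the band);
* `sum_band_swap_le`: `Σ_{i∈F} Σ_{j∈nbr i} g_j ≤ W Σ_{j∈F} g_j` for `g ≥ 0` vanishing off `F`;
* `graph_bound_of_section_eigen`: `Σ_{j∈F} ((x₀ − ℓ_j) c_j)² ≤ 2(x₀ − x)² + 2 W² K² (1 + s − x)`.

Generic (any index type, any real banded matrix); Mathlib only; no definitions. [folklore]
-/

namespace Summit.NavierStokesRegularity.FluidComputer.SkewCutGalerkinSectionGraphBound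

open Finset
open scoped BigOperators

variable {ι : Type*} [DecidableEq ι]

omit [DecidableEq ι] in
/-- **Energy bound.** If `ℓ_i c_i + Σ_{j∈F} a_ij c_j = x c_i` on `F`, `c` normalised on `F`, and the
section pairing bound holds with constant `s`, then `Σ_{i∈F} (−ℓ_i) c_i² ≤ s − x`. -/
theorem energy_bound_of_section_eigen (a : ι → ι → ℝ) (ℓ : ι → ℝ) (s : ℝ)
    (hA : ∀ (G : Finset ι) (u : ι → ℝ), ∑ i ∈ G, ∑ j ∈ G, u i * a i j * u j ≤ s * ∑ i ∈ G, u i ^ 2)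
    (F : Finset ι) (c : ι → ℝ) (hnorm : ∑ i ∈ F, c i ^ 2 = 1) {x : ℝ}
    (heig : ∀ i ∈ F, ℓ i * c i + ∑ j ∈ F, a i j * c j = x * c i) :
    ∑ i ∈ F, (-ℓ i) * c i ^ 2 ≤ s - x := by
  have hsum : ∑ i ∈ F, c i * (ℓ i * c i + ∑ j ∈ F, a i j * c j) = ∑ i ∈ F, c i * (x * c i) :=
    Finset.sum_congr rfl fun i hi => by rw [heig i hi]
  have hx : ∑ i ∈ F, c i * (x * c i) = x := by
    have : ∑ i ∈ F, c i * (x * c i) = x * ∑ i ∈ F, c i ^ 2 := by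
      rw [Finset.mul_sum]; exact Finset.sum_congr rfl fun i _ => by ring
    rw [this, hnorm, mul_one]
  have hlhs : ∑ i ∈ F, c i * (ℓ i * c i + ∑ j ∈ F, a i j * c j) =
      ∑ i ∈ F, ℓ i * c i ^ 2 + ∑ i ∈ F, ∑ j ∈ F, c i * a i j * c j := by
    rw [← Finset.sum_add_distrib]
    refine Finset.sum_congr rfl fun i _ => ?_
    rw [mul_add, Finset.mul_sum]
    congr 1
    · ring
    · exact Finset.sum_congr rfl fun j _ => by ring
  have hpair := hA F c
  rw [hnorm, mul_one] at hpair
  have hneg : ∑ i ∈ F, (-ℓ i) * c i ^ 2 = -∑ i ∈ F, ℓ i * c i ^ 2 := by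
    rw [← Finset.sum_neg_distrib]; exact Finset.sum_congr rfl fun i _ => by ring
  rw [hlhs, hx] at hsum
  linarith

/-- The row action over `F` is the row action over the band (the matrix vanishes off the band, the
vector off `F`). -/
theorem sum_row_eq_sum_band (a : ι → ι → ℝ) (nbr : ι → Finset ι) (ha0 : ∀ i j, j ∉ nbr i → a i j = 0)
    (F : Finset ι) (c : ι → ℝ) (hcF : ∀ i ∉ F, c i = 0) (i : ι) :
    ∑ j ∈ F, a i j * c j = ∑ j ∈ nbr i, a i j * c j := by
  have h1 : ∑ j ∈ F, a i j * c j = ∑ j ∈ F ∪ nbr i, a i j * c j :=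
    Finset.sum_subset Finset.subset_union_left fun j _ hj => by rw [hcF j hj, mul_zero]
  have h2 : ∑ j ∈ nbr i, a i j * c j = ∑ j ∈ F ∪ nbr i, a i j * c j :=
    Finset.sum_subset Finset.subset_union_right fun j _ hj => by rw [ha0 i j hj, zero_mul]
  rw [h1, h2]

omit [DecidableEq ι] in
/-- **Cauchy–Schwarz on the band**: `(Σ_{j∈nbr i} a_ij c_j)² ≤ W K² Σ_{j∈nbr i} w_j² c_j²` when
`card (nbr i) ≤ W` and `|a_ij| ≤ K w_j` on the band. -/
theorem sq_sum_band_le (a : ι → ι → ℝ) (nbr : ι → Finset ι) {W : ℕ} (hW : ∀ i, (nbr i).card ≤ W)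
    (wgt : ι → ℝ) {K : ℝ} (ha : ∀ i j, j ∈ nbr i → |a i j| ≤ K * wgt j)
    (c : ι → ℝ) (i : ι) :
    (∑ j ∈ nbr i, a i j * c j) ^ 2 ≤ (W : ℝ) * K ^ 2 * ∑ j ∈ nbr i, wgt j ^ 2 * c j ^ 2 := by
  have hcs := Finset.sum_mul_sq_le_sq_mul_sq (nbr i) (fun _ => (1 : ℝ)) (fun j => a i j * c j)
  simp only [one_pow, Finset.sum_const, nsmul_eq_mul, mul_one, one_mul] at hcs
  have hcard : ((nbr i).card : ℝ) ≤ W := by exact_mod_cast hW i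
  have hterm : ∀ j ∈ nbr i, (a i j * c j) ^ 2 ≤ K ^ 2 * (wgt j ^ 2 * c j ^ 2) := by
    intro j hj
    have h1 : (a i j) ^ 2 ≤ (K * wgt j) ^ 2 := by
      rw [← sq_abs (a i j)]
      exact pow_le_pow_left₀ (abs_nonneg _) (ha i j hj) 2
    calc (a i j * c j) ^ 2 = a i j ^ 2 * c j ^ 2 := by ring
      _ ≤ (K * wgt j) ^ 2 * c j ^ 2 := mul_le_mul_of_nonneg_right h1 (sq_nonneg _)
      _ = K ^ 2 * (wgt j ^ 2 * c j ^ 2) := by ring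
  have hsum : ∑ j ∈ nbr i, (a i j * c j) ^ 2 ≤ K ^ 2 * ∑ j ∈ nbr i, wgt j ^ 2 * c j ^ 2 := by
    rw [Finset.mul_sum]; exact Finset.sum_le_sum hterm
  have hnn : 0 ≤ ∑ j ∈ nbr i, (a i j * c j) ^ 2 := Finset.sum_nonneg fun j _ => sq_nonneg _
  calc (∑ j ∈ nbr i, a i j * c j) ^ 2 ≤ ((nbr i).card : ℝ) * ∑ j ∈ nbr i, (a i j * c j) ^ 2 := hcs
    _ ≤ (W : ℝ) * ∑ j ∈ nbr i, (a i j * c j) ^ 2 := mul_le_mul_of_nonneg_right hcard hnn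
    _ ≤ (W : ℝ) * (K ^ 2 * ∑ j ∈ nbr i, wgt j ^ 2 * c j ^ 2) :=
        mul_le_mul_of_nonneg_left hsum (Nat.cast_nonneg _)
    _ = (W : ℝ) * K ^ 2 * ∑ j ∈ nbr i, wgt j ^ 2 * c j ^ 2 := by ring

/-- **Band double-counting**: for `g ≥ 0` vanishing off `F` and a symmetric band of width `W`,
`Σ_{i∈F} Σ_{j∈nbr i} g_j ≤ W Σ_{j∈F} g_j`. -/
theorem sum_band_swap_le (nbr : ι → Finset ι) (hsymm : ∀ i j, j ∈ nbr i ↔ i ∈ nbr j) {W : ℕ}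
    (hW : ∀ i, (nbr i).card ≤ W) (F : Finset ι) (g : ι → ℝ) (hg0 : ∀ j, 0 ≤ g j)
    (hgF : ∀ j ∉ F, g j = 0) :
    ∑ i ∈ F, ∑ j ∈ nbr i, g j ≤ (W : ℝ) * ∑ j ∈ F, g j := by
  -- restrict the inner sum to `F` and write it with an indicator
  have h1 : ∀ i, ∑ j ∈ nbr i, g j = ∑ j ∈ F, if j ∈ nbr i then g j else 0 := by
    intro i
    rw [← Finset.sum_filter]
    have hsub : F.filter (fun j => j ∈ nbr i) ⊆ nbr i := fun j hj => (Finset.mem_filter.mp hj).2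
    refine (Finset.sum_subset hsub fun j hj hjn => ?_).symm
    have : j ∉ F := fun hjF => hjn (Finset.mem_filter.mpr ⟨hjF, hj⟩)
    exact hgF j this
  simp_rw [h1]
  rw [Finset.sum_comm, Finset.mul_sum]
  refine Finset.sum_le_sum fun j _ => ?_
  rw [← Finset.sum_filter, Finset.sum_const, nsmul_eq_mul]
  have hsub : F.filter (fun i => j ∈ nbr i) ⊆ nbr j := fun i hi =>
    (hsymm i j).mp (Finset.mem_filter.mp hi).2
  have hcard : ((F.filter fun i => j ∈ nbr i).card : ℝ) ≤ W := by
    exact_mod_cast (Finset.card_le_card hsub).trans (hW j)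
  exact mul_le_mul_of_nonneg_right hcard (hg0 j)

/-- **GRAPH BOUND of a section eigenvector from band + growth + pairing.** Real banded matrix `a`
(symmetric band `nbr` of width `W`, `a = 0` off the band, growth `|a_ij| ≤ K w_j`, `w_j² ≤ 1 + |ℓ_j|`),
levels `ℓ ≤ 0`, section pairing bound with constant `s`. If `c` is supported in the finite `F`,
normalised `Σ_F c_i² = 1`, and `ℓ_i c_i + Σ_{j∈F} a_ij c_j = x c_i` on `F`, then for every `x₀`:
`Σ_{j∈F} ((x₀ − ℓ_j) c_j)² ≤ 2 (x₀ − x)² + 2 W² K² (1 + s − x)` — the `hgraph` input of the END-TO-END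
theorems with a constant uniform in the section. -/
theorem graph_bound_of_section_eigen (a : ι → ι → ℝ) (ℓ : ι → ℝ) (hℓ : ∀ i, ℓ i ≤ 0) (s : ℝ)
    (hA : ∀ (G : Finset ι) (u : ι → ℝ), ∑ i ∈ G, ∑ j ∈ G, u i * a i j * u j ≤ s * ∑ i ∈ G, u i ^ 2)
    (nbr : ι → Finset ι) (hsymm : ∀ i j, j ∈ nbr i ↔ i ∈ nbr j) {W : ℕ} (hW : ∀ i, (nbr i).card ≤ W)
    (ha0 : ∀ i j, j ∉ nbr i → a i j = 0) (wgt : ι → ℝ) (hwℓ : ∀ i, wgt i ^ 2 ≤ 1 + |ℓ i|)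
    {K : ℝ} (ha : ∀ i j, j ∈ nbr i → |a i j| ≤ K * wgt j)
    (F : Finset ι) (c : ι → ℝ) (hcF : ∀ i ∉ F, c i = 0) (hnorm : ∑ i ∈ F, c i ^ 2 = 1) {x : ℝ}
    (heig : ∀ i ∈ F, ℓ i * c i + ∑ j ∈ F, a i j * c j = x * c i) (x₀ : ℝ) :
    ∑ j ∈ F, ((x₀ - ℓ j) * c j) ^ 2 ≤ 2 * (x₀ - x) ^ 2 + 2 * ((W : ℝ) ^ 2 * K ^ 2) * (1 + (s - x)) := by
  have hE := energy_bound_of_section_eigen a ℓ s hA F c hnorm heig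
  -- `(x − ℓ_i) c_i = Σ_{j∈nbr i} a_ij c_j`
  have hrow : ∀ i ∈ F, (x - ℓ i) * c i = ∑ j ∈ nbr i, a i j * c j := by
    intro i hi
    rw [← sum_row_eq_sum_band a nbr ha0 F c hcF i]
    linarith [heig i hi]
  -- `Σ ((x − ℓ) c)² ≤ W² K² Σ_{j∈F} (1 + |ℓ_j|) c_j²`
  set g : ι → ℝ := fun j => (1 + |ℓ j|) * c j ^ 2 with hg
  have hg0 : ∀ j, 0 ≤ g j := fun j => by rw [hg]; positivity
  have hgF : ∀ j ∉ F, g j = 0 := fun j hj => by rw [hg]; dsimp only; rw [hcF j hj]; ring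
  have h1 : ∑ i ∈ F, ((x - ℓ i) * c i) ^ 2 ≤ (W : ℝ) * K ^ 2 * ∑ i ∈ F, ∑ j ∈ nbr i, g j := by
    rw [Finset.mul_sum]
    refine Finset.sum_le_sum fun i hi => ?_
    rw [hrow i hi]
    refine (sq_sum_band_le a nbr hW wgt ha c i).trans ?_
    refine mul_le_mul_of_nonneg_left (Finset.sum_le_sum fun j _ => ?_) (by positivity)
    rw [hg]
    exact mul_le_mul_of_nonneg_right (hwℓ j) (sq_nonneg _)
  have h2 : ∑ i ∈ F, ∑ j ∈ nbr i, g j ≤ (W : ℝ) * ∑ j ∈ F, g j :=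
    sum_band_swap_le nbr hsymm hW F g hg0 hgF
  have h3 : ∑ j ∈ F, g j = 1 + ∑ j ∈ F, (-ℓ j) * c j ^ 2 := by
    rw [← hnorm, ← Finset.sum_add_distrib]
    refine Finset.sum_congr rfl fun j _ => ?_
    rw [hg]; dsimp only
    rw [abs_of_nonpos (hℓ j)]; ring
  have h4 : ∑ i ∈ F, ((x - ℓ i) * c i) ^ 2 ≤ ((W : ℝ) ^ 2 * K ^ 2) * (1 + (s - x)) := by
    have hWK : 0 ≤ (W : ℝ) * K ^ 2 := by positivity
    calc ∑ i ∈ F, ((x - ℓ i) * c i) ^ 2 ≤ (W : ℝ) * K ^ 2 * ∑ i ∈ F, ∑ j ∈ nbr i, g j := h1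
      _ ≤ (W : ℝ) * K ^ 2 * ((W : ℝ) * ∑ j ∈ F, g j) := mul_le_mul_of_nonneg_left h2 hWK
      _ = ((W : ℝ) ^ 2 * K ^ 2) * (1 + ∑ j ∈ F, (-ℓ j) * c j ^ 2) := by rw [h3]; ring
      _ ≤ ((W : ℝ) ^ 2 * K ^ 2) * (1 + (s - x)) :=
          mul_le_mul_of_nonneg_left (by linarith) (by positivity)
  -- `((x₀ − ℓ) c)² ≤ 2 (x₀ − x)² c² + 2 ((x − ℓ) c)²`
  have h5 : ∑ j ∈ F, ((x₀ - ℓ j) * c j) ^ 2 ≤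
      2 * (x₀ - x) ^ 2 * ∑ j ∈ F, c j ^ 2 + 2 * ∑ j ∈ F, ((x - ℓ j) * c j) ^ 2 := by
    rw [Finset.mul_sum, Finset.mul_sum, ← Finset.sum_add_distrib]
    refine Finset.sum_le_sum fun j _ => ?_
    nlinarith [sq_nonneg ((x₀ - x) * c j - (x - ℓ j) * c j)]
  rw [hnorm, mul_one] at h5
  linarith

end Summit.NavierStokesRegularity.FluidComputer.SkewCutGalerkinSectionGraphBound
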